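import Summits.QuantumFields.YangMills.Theorems.BalabanUVNodesN26AtRecord12
import Literature.MathematicalPhysics.QuantumFieldTheory.Balaban1983to89.Beta.RemainderWOfRecordB13

/-!
# DAG node N26 — B4 AT `Node00.betaOfRecord₁₁ θ` (and at the Stage-12 datum): THE (D4)-CHAIN INSTANCE AT THE RECORD'S SPLIT
# BUILT BY NAME FROM NODE 00's [B13] RESIDUAL LAYER SEQUENCES AND N10's [B13] LEAF — the junction of the row-(D4) owner's
# `W`-adapter `Beta.RemainderWOfRecordB13.polLeavesTFac190H_ofRecordB13` (p462936) with dag-n26-c's leaf-list ∕ residue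
# currency at the record (`…N26AtBetaOfRecord11StepObjects` p457986 §2, `…N26AtRecord12` p461633 §1 ∕ §4)

Cell pub-balaban, β-function sub-cell, BINDER row (D4) OWNER lineage `b2b-balaban-beta-an4` (gen 124; memo
`HOME/b2b-balaban-beta-an4/FLAT-LETTERS-LOCATED.md` §33 (iv) «CONSUMERS: dag-n26-c's `…N26AtBetaOfRecord11StepObjects` §2
takes `L k p hp := polLeavesTFac190H_ofRecordB13 (lam k p) …`»; pub-ymgap bus l.13631 = dag-n26-c g2 CLOSE «(t8) any NODE O
(D4)∕(D1) object at the record ⇒ instantiate p456171 §3 ∕ p457986 §3 ∕ p461633 §4»).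

WHY THIS FILE.  p457986 §3 (`exists_chainTFac190H_oneLoopSplitOfRecord₁₁_of_stepObjects`) lists, per (scale, history), an
exhausting torus family `Nt k p`, THIN STEP OBJECTS `O k p n : StepObjectD4 4 (Nt k p n)` and Lemma 3 (2.38) `Lemma3OnH c ℓ`
on them as DISPLAYED HYPOTHESES.  Since p457685 (`Node00/CarriersB13.lean`) NODE 00's [B13] carrier pin DEFINES, for every
residual term layer `lam : Node00.ResidB13 θ₃`, the two-scale torus step of record `Node00.WtOfRecord θ₃ lam` (parametric in
the coarse torus `lam.n + 1`), the constants of record `c13OfRecord θ₃ lam`, and N10's output predicate at the layer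
`Node00.B13LeafOfRecord θ₃ lam` (= [II] Lemmas 1–3 AS PRINTED for that step); and since p462936 the row-(D4) owner's adapter
`polLeavesTFac190H_ofRecordB13` turns a (1.21) SEQUENCE of such layers `lam : ℕ → ResidB13 θ₃` with `(lam m).n ↗`, the two
one-line laws `SpLaw` ∕ `Law213` (p. 15 restriction, (2.13)), N10's leaf + `Restr` on every layer, and EXACTLY the remaining
(4.4) ∕ (190) ∕ (1.7) leaves stated on the layers' own `Φ ∕ sp2 ∕ H ∕ Ek1` into the (D4) wall `PolLeavesTFac190H 4 M a c (L∕2) α₂ q`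
(its `W m` IS `(WtOfRecord θ₃ (lam m)).toTorusStep`, its `N m` IS `(lam m).n + 1`).  This module writes the composition nobody
had written: the (D4)-chain at `oneLoopSplitOfRecord₁₁ θ` as an EXPLICIT OBJECT whose per-(k, p) leaf lists are the adapter's
(§1: `chainTFac190H_ofB13Layers`, with the `rfl` handles `…_A1`, `…_leaves_W`, `…_leaves_N` that serve dag-ref-D's
WATCH-D4-TORUS-SEQUENCE read rule BY TYPE), and its consumers at the record in dag-n26-c's words: B4 at `betaOfRecord₁₁`
(§2 `betaContH_betaOfRecord₁₁_of_b13Layers`), the rows-(D4) ∧ B4 residue (`atSlopeCont_oneLoopSplitOfRecord₁₁_of_b13Layers`),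
N25's END ∧ N26 at the Stage-11 datum with row (D1)'s residue (`endpoint_and_n26_datumOfRecord₁₁_of_b13Layers`), and the
Stage-12 twins at the view (§3 `n26_datumOfRecord₁₂_of_b13Layers_view`, `endpoint_and_n26_datumOfRecord₁₂_of_b13Layers_view`).
Compared with p457986 §3 two displayed hypotheses change currency: the step objects `O k p n` become NODE 00's residual layers
`lam k p m : ResidB13 θ.toStage3Params`, and `Lemma3OnH c ℓ` becomes N10's [B13] leaf `B13LeafOfRecord` + `Restr` at common
constants of record (`hc`), at the printed transfer factor ℓ = ½L.

HONEST FRAMING.  Compositions BY NAME (1 `def` = a structure instance assembled from hypotheses, 0 `sorry`, no estimate);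
nothing of Bałaban's is constructed or asserted: the layer SEQUENCES with `(lam k p m).n ↗` per (scale, history) (NODE O ∕ 00
— the record predicate carries ONE layer per run; «(1.21) sequence = separate object», `CarriersB13` ll. 61–64), N10's leaf on
every layer (NODE A = N10's own discharge, 0∕1), the laws `SpLaw`∕`Law213`, the (4.4) seams + activities holomorphy (NODE B),
`Data190` on the layers' tori (NODE D), the (1.7)∕(1.21) test-vector data (NODE E), the (1.22) identification in the record's
letters and (C-pt) are ALL displayed hypotheses — INSTANCE 0∕1, D4 DISCHARGE NO DATE; θ-keyed implications only (no
record-predicate ∀-form); N25 ∕ N26 NOT discharged; counts unmoved.  One finite four-torus programme at fixed ε per run — NOT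
the continuum limit, NOT ℝ⁴, NOT infinite volume, NOT OS, NOT a mass gap, NOT Clay.  No `instance`, no `notation`, no `axiom`.
Sources (context): [I] = [Balaban1987RG1] CMP **109** (1987): Thm 2 p. 259, (1.7) p. 261, (1.20)–(1.22) p. 264, (2.12)–(2.13)
p. 268, (4.4) p. 281, (5.10) p. 293; [II] = [Balaban1988RG2Cluster] CMP **116** (1988): (2.9)∕(2.13) p. 14, p. 15, Lemma 3
(2.38) p. 20, p. 21 (ℓ = ½L); [15] = [Balaban1985Variational] CMP **102** (1985): (190) p. 308.
-/

noncomputable section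

open scoped Matrix.Norms.L2Operator

namespace Summit.QuantumFields.YangMills.Theorems.BalabanUVNodesN26AtBetaOfRecord11B13Layers

open Literature.MathematicalPhysics.QuantumFieldTheory.Balaban1983to89
open Literature.MathematicalPhysics.QuantumFieldTheory.Balaban1983to89.FlowStep
open Literature.MathematicalPhysics.QuantumFieldTheory.Balaban1983to89.DagBinding (EndpointExistence)
open Literature.MathematicalPhysics.QuantumFieldTheory.Balaban1983to89.T4Continuum (T4Family)
open Literature.MathematicalPhysics.QuantumFieldTheory.Balaban1983to89.Node00
open Literature.MathematicalPhysics.QuantumFieldTheory.Balaban1983to89.B13ScaleTransfer (Pt)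
open Literature.MathematicalPhysics.QuantumFieldTheory.Balaban1983to89.TreeLengthTorus (TDom proj)
open Literature.MathematicalPhysics.QuantumFieldTheory.Balaban1983to89.B12Decay510 (mixedDeriv)
open Literature.MathematicalPhysics.QuantumFieldTheory.Balaban1983to89.Beta.RemainderChainLattice
open Literature.MathematicalPhysics.QuantumFieldTheory.Balaban1983to89.Beta.RemainderLimitTorus (LDom limKernel tproj)
open Literature.MathematicalPhysics.QuantumFieldTheory.Balaban1983to89.Beta.RemainderDecay190 (Consts190 Data190)
open Literature.MathematicalPhysics.QuantumFieldTheory.Balaban1983to89.Beta.RemainderLocalityHolo (PolLeavesTFac190H)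
open Literature.MathematicalPhysics.QuantumFieldTheory.Balaban1983to89.Beta.RemainderDecay190HoloChain (ChainTFac190H)
open Literature.MathematicalPhysics.QuantumFieldTheory.Balaban1983to89.Beta.RemainderWOfRecordB13
  (SpLaw Law213 NOfLayers polLeavesTFac190H_ofRecordB13)
open Literature.MathematicalPhysics.QuantumFieldTheory.Balaban1983to89.Beta.OneStepKernelFamily (TbalOf)
open Literature.MathematicalPhysics.QuantumFieldTheory.Balaban1983to89.Beta.OneStepResolventKernel (JetData)
open Summit.QuantumFields.BalabanUV.Gaps
open Summit.QuantumFields.BalabanUV.Gaps.BetaContFromD4Chain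
open Summit.QuantumFields.YangMills.Theorems.BalabanUVNodesN26AtBetaOfRecord11
  (endpoint_and_n26_datumOfRecord₁₁_of_residue_atSlopeCont)
open Summit.QuantumFields.YangMills.Theorems.BalabanUVNodesN26AtBetaOfRecord11StepObjects
  (beta1_eq_oneLoopSplitOfRecord₁₁_of_merged betaContH_betaOfRecord₁₁_of_exists_chainTFac190H
    atSlopeCont_oneLoopSplitOfRecord₁₁_of_exists_chainTFac190H)
open Summit.QuantumFields.YangMills.Theorems.BalabanUVNodesN26AtRecord12
  (n26_datumOfRecord₁₂_of_exists_chainTFac190H_view endpoint_and_n26_datumOfRecord₁₂_of_residue_atSlopeCont)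
open Metric Filter Topology

variable (F : T4Family) (N : ℕ) [NeZero N]

/-! ## §1 The (D4)-chain at the record's split as an explicit object over NODE 00's [B13] layer sequences -/

section Layers

variable {γ₀ : ℝ} {M : ℕ} [NeZero M] {μ ν : Fin 4} {c : B13.Consts} {α₂ : ℝ} {q : Consts190}
variable (θ : Stage11Params F N) (hle : γ₀ ≤ θ.γ)
  (A1 : (k : ℕ) → (Fin (k + 1) → ℝ) → LDom 4 → Pt 4 → ℝ)
  (hm : ∀ k (p : Fin (k + 1) → ℝ), p ∈ Box γ₀ k →
    betaMergedOfRecord₁₁ F N θ k p = beta0OfRecord₁₁ F N θ k + B12Beta.secondMoment (fun _ _ => limKernel (A1 k p)) μ ν)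
  -- per (scale, history): a (1.21) SEQUENCE of NODE 00's [B13] residual layers with growing coarse tori, at common constants
  (lam : (k : ℕ) → (Fin (k + 1) → ℝ) → ℕ → ResidB13 θ.toStage3Params)
  (hn : ∀ k p, Tendsto (fun m => (lam k p m).n) atTop atTop)
  (hc : ∀ k p m, c13OfRecord θ.toStage3Params (lam k p m) = c)
  -- the two one-step laws in the layer's words, N10's [B13] leaf and the restriction sentence on every layer
  (hsp : ∀ k p m, SpLaw (lam k p m)) (h213 : ∀ k p m, Law213 (lam k p m))
  (hleaf : ∀ k p m, B13LeafOfRecord θ.toStage3Params (lam k p m)) (hR : ∀ k p m, (lam k p m).Restr)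
  (hC : CondsL 4 c ((c.L : ℝ) / 2)) (hs : SignsL c α₂ q.B₃)
  -- the (4.4) seams into the layers' analyticity domains, with the layers' ACTIVITIES holomorphic along them
  (Wn : (k : ℕ) → (Fin (k + 1) → ℝ) → ℕ → Type) (instW : ∀ k p m, NormedAddCommGroup (Wn k p m))
  (instWs : ∀ k p m, NormedSpace ℂ (Wn k p m))
  (emb : (k : ℕ) → (p : Fin (k + 1) → ℝ) → (m : ℕ) → TDom 4 ((lam k p m).n + 1) → Wn k p m → (lam k p m).Φ)
  (hemb : ∀ k p m X, ∀ v ∈ ball (0 : Wn k p m) α₂, emb k p m X v ∈ (lam k p m).sp2 X)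
  (hH : ∀ k p m (X Z : TDom 4 ((lam k p m).n + 1)), Z.1 ⊆ X.1 →
    DifferentiableOn ℂ (fun v => (lam k p m).H Z (emb k p m X v)) (ball 0 α₂))
  -- the (190)-side data on the layers' tori and the (1.7) ∕ test-vector-limit data with the read-out of the leaf kernels
  (D : (k : ℕ) → (p : Fin (k + 1) → ℝ) → Data190 4 M (NOfLayers (lam k p)) (Wn k p) q)
  (V : (k : ℕ) → (Fin (k + 1) → ℝ) → LDom 4 → Type) (instV : ∀ k p Y, NormedAddCommGroup (V k p Y))
  (instVs : ∀ k p Y, NormedSpace ℂ (V k p Y))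
  (Fw : (k : ℕ) → (p : Fin (k + 1) → ℝ) → (Y : LDom 4) → V k p Y → ℂ)
  (hFd : ∀ k p Y, ∃ ρ > 0, DifferentiableOn ℂ (Fw k p Y) (ball 0 ρ))
  (r : (k : ℕ) → (p : Fin (k + 1) → ℝ) → (m : ℕ) → (Y : LDom 4) → Wn k p m →L[ℂ] V k p Y)
  (hfac : ∀ k p (Y : LDom 4), ∀ᶠ m in atTop, ∀ v ∈ ball (0 : Wn k p m) α₂,
    (lam k p m).Ek1 (tproj ((lam k p m).n + 1) Y) (emb k p m (tproj ((lam k p m).n + 1) Y) v) = Fw k p Y (r k p m Y v))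
  (t : (k : ℕ) → (p : Fin (k + 1) → ℝ) → (Y : LDom 4) → Pt 4 → V k p Y)
  (hconv : ∀ k p (Y : LDom 4) (x : Pt 4),
    Tendsto (fun m => r k p m Y ((D k p).hn m (tproj ((lam k p m).n + 1) Y) (proj (((lam k p m).n + 1) * M) x)))
      atTop (𝓝 (t k p Y x)))
  (ha : ∀ k p (Y : LDom 4) (z : Pt 4), A1 k p Y z = (mixedDeriv (Fw k p Y) (t k p Y 0) (t k p Y z)).re)

include hle hm hn hc hsp h213 hleaf hR hC hs instW instWs hemb hH hFd hfac hconv ha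

/-- **THE (D4)-CHAIN AT THE RECORD'S SPLIT OVER NODE 00's [B13] LAYER SEQUENCES, AS AN OBJECT**: leaf kernels `A1` with the
(1.22) identification in the record's letters on a box `γ₀ ≤ θ.γ` (p457986 §1), and PER (k, p): a (1.21) sequence of residual
term layers `lam k p : ℕ → ResidB13 θ.toStage3Params` with `(lam k p m).n ↗` at common constants of record `c`, the laws
`SpLaw` ∕ `Law213`, N10's [B13] leaf `B13LeafOfRecord` + `Restr` on every layer, the (4.4) seams with the layers' activities
holomorphic along them, `Data190` on the layers' tori and the (1.7) ∕ test-vector data with the read-out `ha` — assembled into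
`ChainTFac190H 4 M μ ν (oneLoopSplitOfRecord₁₁ F N θ) γ₀ c (L∕2) α₂ q` whose per-(k, p) leaf list IS the row-(D4) owner's
`polLeavesTFac190H_ofRecordB13 (lam k p) …` (ℓ = ½L as printed, p. 21).  Every input a displayed hypothesis of NODE O ∕ A ∕
B ∕ D ∕ E; instance 0∕1. [cite: Balaban1987RG1, (1.7) p.261, (1.20)-(1.22) p.264, (4.4) p.281; Balaban1988RG2Cluster, (2.13) p.14, p.15, Lemma 3 (2.38) p.20 and p.21; Balaban1985Variational, (190) p.308] -/
def chainTFac190H_ofB13Layers :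
    ChainTFac190H 4 M μ ν (oneLoopSplitOfRecord₁₁ F N θ) γ₀ c ((c.L : ℝ) / 2) α₂ q where
  A1 := A1
  beta1_eq := beta1_eq_oneLoopSplitOfRecord₁₁_of_merged F N θ hle A1 hm
  leaves k p _ :=
    polLeavesTFac190H_ofRecordB13 (lam k p) (hn k p) c α₂ q (hc k p) (hsp k p) (h213 k p) (hleaf k p) (hR k p) hC
      hs.A (Wn k p) (instW := instW k p) (instWs := instWs k p) (emb k p) (hemb k p) (hH k p) (D k p) (V k p)
      (instV := instV k p) (instVs := instVs k p) (Fw k p) (hFd k p) (r k p) (hfac k p) (t k p) (hconv k p) (A1 k p)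
      (ha k p)

/-- The chain's leaf kernels ARE the given `A1` (`rfl`) — so (C-pt) `CPt R` IS the displayed clause on `A1`.
[cite: Balaban1987RG1, (1.22) p.264 (bookkeeping)] -/
theorem chainTFac190H_ofB13Layers_A1 :
    (chainTFac190H_ofB13Layers F N θ hle A1 hm lam hn hc hsp h213 hleaf hR hC hs Wn instW instWs emb hemb hH D V instV
      instVs Fw hFd r hfac t hconv ha).A1 = A1 :=
  rfl

/-- **WATCH-D4-TORUS-SEQUENCE handle (tori)**: the chain's (k, p)-leaf list runs over the tori `m ↦ (lam k p m).n + 1` of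
the layer sequence (`rfl`) — with `hn k p` a displayed binder, never a constant sequence. [cite: Balaban1987RG1, (1.21) p.264] -/
theorem chainTFac190H_ofB13Layers_leaves_N (k : ℕ) (p : Fin (k + 1) → ℝ) (hp : p ∈ B12Beta.HistBox γ₀ k) :
    ((chainTFac190H_ofB13Layers F N θ hle A1 hm lam hn hc hsp h213 hleaf hR hC hs Wn instW instWs emb hemb hH D V instV
      instVs Fw hFd r hfac t hconv ha).leaves k p hp).N = fun m => (lam k p m).n + 1 :=
  rfl

/-- **WATCH-D4-TORUS-SEQUENCE handle (steps)**: the chain's (k, p)-leaf list's one-step data `W m` IS the two-scale torus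
step of record of the m-th layer, `(WtOfRecord θ.toStage3Params (lam k p m)).toTorusStep` (`rfl`).
[cite: Balaban1987RG1, (1.21) p.264; Balaban1988RG2Cluster, (1.1)-(2.13) pp.3-14 (carrier)] -/
theorem chainTFac190H_ofB13Layers_leaves_W (k : ℕ) (p : Fin (k + 1) → ℝ) (hp : p ∈ B12Beta.HistBox γ₀ k) :
    ((chainTFac190H_ofB13Layers F N θ hle A1 hm lam hn hc hsp h213 hleaf hR hC hs Wn instW instWs emb hemb hH D V instV
      instVs Fw hFd r hfac t hconv ha).leaves k p hp).W =
      fun m => (WtOfRecord θ.toStage3Params (lam k p m)).toTorusStep :=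
  rfl

/-- **THE (D4)-CHAIN INSTANCE AT THE RECORD'S SPLIT FROM NODE 00's [B13] LAYER SEQUENCES, LEAF KERNELS EXPOSED** (the
currency p457986 §2's consumers take): `∃ R : ChainTFac190H 4 M μ ν (oneLoopSplitOfRecord₁₁ F N θ) γ₀ c (L∕2) α₂ q, R.A1 = A1`.
Instance 0∕1 for Bałaban's objects. [cite: Balaban1987RG1, (1.7) p.261, (1.20)-(1.22) p.264, (4.4) p.281; Balaban1988RG2Cluster, p.15, Lemma 3 (2.38) p.20 and p.21; Balaban1985Variational, (190) p.308] -/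
theorem exists_chainTFac190H_oneLoopSplitOfRecord₁₁_of_b13Layers :
    ∃ R : ChainTFac190H 4 M μ ν (oneLoopSplitOfRecord₁₁ F N θ) γ₀ c ((c.L : ℝ) / 2) α₂ q, R.A1 = A1 :=
  ⟨chainTFac190H_ofB13Layers F N θ hle A1 hm lam hn hc hsp h213 hleaf hR hC hs Wn instW instWs emb hemb hH D V instV
      instVs Fw hFd r hfac t hconv ha, rfl⟩

/-! ## §2 B4, the rows-(D4) ∧ B4 residue, and N25's END ∧ N26 at the Stage-11 record from the layer lists -/

/-- **HOW B4 CLOSES AT THE β OF RECORD FROM NODE 00's [B13] LAYERS AND N10's LEAF, in one statement**: the layer list of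
`chainTFac190H_ofB13Layers`, the (1.22) identification in the record's letters, N1–N3 (`CondsL`, `R22gen (L∕2)` ⇔
(1 − 10δ)·½L = 1, `Valid`, `SignsL`) and (C-pt) on the leaf kernels ⟹ `BetaContH γ₀ (betaOfRecord₁₁ F N θ)` for EVERY
`θ : Stage11Params` with `γ₀ ≤ θ.γ`.  Displayed so that NODE O ∕ 00 and N10 see, at the record, the complete list under which
the tree derives binder B4 from THEIR objects and output predicate; nothing of Bałaban's asserted (instance 0∕1).
[cite: Balaban1987RG1, (1.7) p.261, (1.20)-(1.22) p.264, (4.4) p.281 and (5.10) p.293; Balaban1988RG2Cluster, p.15, Lemma 3 (2.38) p.20 and p.21; Balaban1985Variational, (190) p.308] -/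
theorem betaContH_betaOfRecord₁₁_of_b13Layers (h22 : c.R22gen ((c.L : ℝ) / 2)) (hq : q.Valid c.δ₀)
    (hcpt : ∀ k (x : Pt 4), ContinuousOn (fun p : Fin (k + 1) → ℝ => limKernel (A1 k p) x) (Box γ₀ k)) :
    BetaContH γ₀ (betaOfRecord₁₁ F N θ) :=
  betaContH_betaOfRecord₁₁_of_exists_chainTFac190H F N θ
    (exists_chainTFac190H_oneLoopSplitOfRecord₁₁_of_b13Layers F N θ hle A1 hm lam hn hc hsp h213 hleaf hR hC hs Wn instW
      instWs emb hemb hH D V instV instVs Fw hFd r hfac t hconv ha) hC h22 hq hs hcpt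

/-- **THE ROWS-(D4) ∧ B4 RESIDUE AT THE RECORD'S SPLIT FROM NODE 00's [B13] LAYERS**: the same layer list, the (1.22)
identification in the record's letters, N1–N3, smallness `ε₁·K_rem,L∕2 ≤ s` and (C-pt) on the leaf kernels ⟹
`AtSlopeCont (oneLoopSplitOfRecord₁₁ F N θ) γ₀ s` — what N25's END consumes at `s := stepBal Nc Lc`.  Instance 0∕1.
[cite: Balaban1988RG2Cluster, p.15, Lemma 3 (2.38) p.20 and p.21; Balaban1987RG1, (1.7) p.261, (1.20)-(1.22) p.264, (4.4) p.281 and (5.10) p.293; Balaban1985Variational, (190) p.308] -/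
theorem atSlopeCont_oneLoopSplitOfRecord₁₁_of_b13Layers (h22 : c.R22gen ((c.L : ℝ) / 2)) (hq : q.Valid c.δ₀) {s : ℝ}
    (hsmall : c.ε₁ * remCoeffL 4 M c α₂ q.B₃ ≤ s)
    (hcpt : ∀ k (x : Pt 4), ContinuousOn (fun p : Fin (k + 1) → ℝ => limKernel (A1 k p) x) (Box γ₀ k)) :
    AtSlopeCont (oneLoopSplitOfRecord₁₁ F N θ) γ₀ s :=
  atSlopeCont_oneLoopSplitOfRecord₁₁_of_exists_chainTFac190H F N θ
    (exists_chainTFac190H_oneLoopSplitOfRecord₁₁_of_b13Layers F N θ hle A1 hm lam hn hc hsp h213 hleaf hR hC hs Wn instW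
      instWs emb hemb hH D V instV instVs Fw hFd r hfac t hconv ha) hC h22 hq hs hsmall hcpt

/-- **N25's END ∧ N26 AT THE STAGE-11 DATUM FROM NODE 00's [B13] LAYERS + ROW (D1)'s RESIDUE**: row (D1)'s residue
`Gaps.D1Residue.Residue Lc Js Nc μ' ν'` pinned on `beta0OfRecord₁₁ θ`, and on a box `0 < γ₀ ≤ θ.γ` the layer list of
`chainTFac190H_ofB13Layers`, N1–N3, the one-loop slope `ε₁·K_rem,L∕2 ≤ stepBal Nc Lc` and (C-pt) ⟹
`EndpointExistence D.C.toB12 ∧ ∃ γc > 0, BetaContH γc D.βfun` at `D := datumOfRecord₁₁ F N θ hP` (p456171's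
`endpoint_and_n26_datumOfRecord₁₁_of_residue_atSlopeCont`).  Instance 0∕1 on (D1) and (D4); N25 ∕ N26 NOT discharged.
[cite: Balaban1987RG1, Thm 2 p.259 (first sentence), (1.7) p.261 and (1.20)-(1.22) p.264; Balaban1988RG2Cluster, Lemma 3 (2.38) p.20 and p.21] -/
theorem endpoint_and_n26_datumOfRecord₁₁_of_b13Layers (hP : θ.Provisos₁₁) {Lc : ℕ} [NeZero Lc] (Js : ℕ → JetData 3 Lc)
    {Nc : ℝ} {μ' ν' : Fin 4} (hβ : ∀ j, beta0OfRecord₁₁ F N θ j = B12Beta.secondMoment (TbalOf Lc Js j) μ' ν')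
    (h1 : D1Residue.Residue Lc Js Nc μ' ν') (hγ₀ : 0 < γ₀) (h22 : c.R22gen ((c.L : ℝ) / 2)) (hq : q.Valid c.δ₀)
    (hsmall : c.ε₁ * remCoeffL 4 M c α₂ q.B₃ ≤ B12Normalization.stepBal Nc Lc)
    (hcpt : ∀ k (x : Pt 4), ContinuousOn (fun p : Fin (k + 1) → ℝ => limKernel (A1 k p) x) (Box γ₀ k)) :
    EndpointExistence (datumOfRecord₁₁ F N θ hP).C.toB12 ∧
      ∃ γc : ℝ, 0 < γc ∧ BetaContH γc (datumOfRecord₁₁ F N θ hP).βfun :=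
  endpoint_and_n26_datumOfRecord₁₁_of_residue_atSlopeCont F N θ hP Js hβ h1 hγ₀
    (atSlopeCont_oneLoopSplitOfRecord₁₁_of_b13Layers F N θ hle A1 hm lam hn hc hsp h213 hleaf hR hC hs Wn instW instWs emb
      hemb hH D V instV instVs Fw hFd r hfac t hconv ha h22 hq hsmall hcpt)

end Layers

/-! ## §3 The Stage-12 twins at the view `θ.toStage11 F N p` (p461633 §1 ∕ §4 BY NAME) -/

section Stage12

variable {γ₀ : ℝ} {M : ℕ} [NeZero M] {μ ν : Fin 4} {c : B13.Consts} {α₂ : ℝ} {q : Consts190}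
variable (θ : Stage12Params F N) (hP : θ.Provisos₁₂ F N) (p : B12.RunParams) (hle : γ₀ ≤ θ.γ)
  (A1 : (k : ℕ) → (Fin (k + 1) → ℝ) → LDom 4 → Pt 4 → ℝ)
  (hm : ∀ k (v : Fin (k + 1) → ℝ), v ∈ Box γ₀ k →
    betaMergedOfRecord₁₁ F N (θ.toStage11 F N p) k v =
      beta0OfRecord₁₁ F N (θ.toStage11 F N p) k + B12Beta.secondMoment (fun _ _ => limKernel (A1 k v)) μ ν)
  (lam : (k : ℕ) → (Fin (k + 1) → ℝ) → ℕ → ResidB13 θ.toStage3Params)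
  (hn : ∀ k v, Tendsto (fun m => (lam k v m).n) atTop atTop)
  (hc : ∀ k v m, c13OfRecord θ.toStage3Params (lam k v m) = c)
  (hsp : ∀ k v m, SpLaw (lam k v m)) (h213 : ∀ k v m, Law213 (lam k v m))
  (hleaf : ∀ k v m, B13LeafOfRecord θ.toStage3Params (lam k v m)) (hR : ∀ k v m, (lam k v m).Restr)
  (hC : CondsL 4 c ((c.L : ℝ) / 2)) (h22 : c.R22gen ((c.L : ℝ) / 2)) (hq : q.Valid c.δ₀) (hs : SignsL c α₂ q.B₃)
  (Wn : (k : ℕ) → (Fin (k + 1) → ℝ) → ℕ → Type) (instW : ∀ k v m, NormedAddCommGroup (Wn k v m))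
  (instWs : ∀ k v m, NormedSpace ℂ (Wn k v m))
  (emb : (k : ℕ) → (v : Fin (k + 1) → ℝ) → (m : ℕ) → TDom 4 ((lam k v m).n + 1) → Wn k v m → (lam k v m).Φ)
  (hemb : ∀ k v m X, ∀ w ∈ ball (0 : Wn k v m) α₂, emb k v m X w ∈ (lam k v m).sp2 X)
  (hH : ∀ k v m (X Z : TDom 4 ((lam k v m).n + 1)), Z.1 ⊆ X.1 →
    DifferentiableOn ℂ (fun w => (lam k v m).H Z (emb k v m X w)) (ball 0 α₂))
  (D : (k : ℕ) → (v : Fin (k + 1) → ℝ) → Data190 4 M (NOfLayers (lam k v)) (Wn k v) q)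
  (V : (k : ℕ) → (Fin (k + 1) → ℝ) → LDom 4 → Type) (instV : ∀ k v Y, NormedAddCommGroup (V k v Y))
  (instVs : ∀ k v Y, NormedSpace ℂ (V k v Y))
  (Fw : (k : ℕ) → (v : Fin (k + 1) → ℝ) → (Y : LDom 4) → V k v Y → ℂ)
  (hFd : ∀ k v Y, ∃ ρ > 0, DifferentiableOn ℂ (Fw k v Y) (ball 0 ρ))
  (r : (k : ℕ) → (v : Fin (k + 1) → ℝ) → (m : ℕ) → (Y : LDom 4) → Wn k v m →L[ℂ] V k v Y)
  (hfac : ∀ k v (Y : LDom 4), ∀ᶠ m in atTop, ∀ w ∈ ball (0 : Wn k v m) α₂,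
    (lam k v m).Ek1 (tproj ((lam k v m).n + 1) Y) (emb k v m (tproj ((lam k v m).n + 1) Y) w) = Fw k v Y (r k v m Y w))
  (t : (k : ℕ) → (v : Fin (k + 1) → ℝ) → (Y : LDom 4) → Pt 4 → V k v Y)
  (hconv : ∀ k v (Y : LDom 4) (x : Pt 4),
    Tendsto (fun m => r k v m Y ((D k v).hn m (tproj ((lam k v m).n + 1) Y) (proj (((lam k v m).n + 1) * M) x)))
      atTop (𝓝 (t k v Y x)))
  (ha : ∀ k v (Y : LDom 4) (z : Pt 4), A1 k v Y z = (mixedDeriv (Fw k v Y) (t k v Y 0) (t k v Y z)).re)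
  (hcpt : ∀ k (x : Pt 4), ContinuousOn (fun v : Fin (k + 1) → ℝ => limKernel (A1 k v) x) (Box γ₀ k))

include hP hle hm hn hc hsp h213 hleaf hR hC h22 hq hs instW instWs hemb hH hFd hfac hconv ha hcpt

/-- **N26 AT THE STAGE-12 DATUM FROM NODE 00's [B13] LAYERS AT THE VIEW** (any run `p`): the layer list of §1 over
`θ.toStage3Params` (= the view's Stage-3 part, `rfl`), the (1.22) identification in the VIEW's record letters on a box
`0 < γ₀ ≤ θ.γ`, N1–N3 and (C-pt) ⟹ `∃ γc > 0, BetaContH γc (datumOfRecord₁₂ F N θ hP).βfun` (p461633's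
`n26_datumOfRecord₁₂_of_exists_chainTFac190H_view`; the β agrees by `rfl`).  Instance 0∕1.
[cite: Balaban1987RG1, (1.7) p.261, (1.20)-(1.22) p.264 and (5.10) p.293; Balaban1988RG2Cluster, Lemma 3 (2.38) p.20 and p.21; Balaban1985Variational, (190) p.308] -/
theorem n26_datumOfRecord₁₂_of_b13Layers_view (hγ₀ : 0 < γ₀) :
    ∃ γc : ℝ, 0 < γc ∧ BetaContH γc (datumOfRecord₁₂ F N θ hP).βfun :=
  n26_datumOfRecord₁₂_of_exists_chainTFac190H_view F N θ hP p hγ₀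
    (exists_chainTFac190H_oneLoopSplitOfRecord₁₁_of_b13Layers F N (θ.toStage11 F N p) hle A1 hm lam hn hc hsp h213 hleaf
      hR hC hs Wn instW instWs emb hemb hH D V instV instVs Fw hFd r hfac t hconv ha) hC h22 hq hs hcpt

/-- **N25's END ∧ N26 AT THE STAGE-12 DATUM FROM NODE 00's [B13] LAYERS AT THE VIEW + ROW (D1)'s RESIDUE**: row (D1)'s
residue pinned on the view's one-loop number of record `beta0OfRecord₁₁ (θ.toStage11 F N p)` (= the one-loop field of EVERY
split of the datum's β, p461633 §0), the layer list of §1 at the view, N1–N3, the one-loop slope and (C-pt) ⟹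
`EndpointExistence D.C.toB12 ∧ ∃ γc > 0, BetaContH γc D.βfun` at `D := datumOfRecord₁₂ F N θ hP` (p461633's
`endpoint_and_n26_datumOfRecord₁₂_of_residue_atSlopeCont` at the split `oneLoopSplitOfRecord₁₁ F N (θ.toStage11 F N p)`).
Instance 0∕1 on (D1) and (D4); N25 ∕ N26 NOT discharged. [cite: Balaban1987RG1, Thm 2 p.259 (first sentence), (1.7) p.261 and (1.20)-(1.22) p.264; Balaban1988RG2Cluster, Lemma 3 (2.38) p.20 and p.21] -/
theorem endpoint_and_n26_datumOfRecord₁₂_of_b13Layers_view {Lc : ℕ} [NeZero Lc] (Js : ℕ → JetData 3 Lc) {Nc : ℝ}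
    {μ' ν' : Fin 4} (hβ : ∀ j, beta0OfRecord₁₁ F N (θ.toStage11 F N p) j = B12Beta.secondMoment (TbalOf Lc Js j) μ' ν')
    (h1 : D1Residue.Residue Lc Js Nc μ' ν') (hγ₀ : 0 < γ₀)
    (hsmall : c.ε₁ * remCoeffL 4 M c α₂ q.B₃ ≤ B12Normalization.stepBal Nc Lc) :
    EndpointExistence (datumOfRecord₁₂ F N θ hP).C.toB12 ∧
      ∃ γc : ℝ, 0 < γc ∧ BetaContH γc (datumOfRecord₁₂ F N θ hP).βfun :=
  endpoint_and_n26_datumOfRecord₁₂_of_residue_atSlopeCont F N θ hP (oneLoopSplitOfRecord₁₁ F N (θ.toStage11 F N p)) Js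
    hβ h1 hγ₀
    (atSlopeCont_oneLoopSplitOfRecord₁₁_of_b13Layers F N (θ.toStage11 F N p) hle A1 hm lam hn hc hsp h213 hleaf hR hC hs
      Wn instW instWs emb hemb hH D V instV instVs Fw hFd r hfac t hconv ha h22 hq hsmall hcpt)

end Stage12

end Summit.QuantumFields.YangMills.Theorems.BalabanUVNodesN26AtBetaOfRecord11B13Layers

end
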